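/-
Copyright (c) 2026 the pub-hodgecm-mathlib formalisation cell (harness21).  Prover seat hodgecm-mathlib-LH4-p04 (g7), req620 Track A «(D-RAM) FOUR-FRAME» squad
(STAGE-1b, row (2); the (R2) cut twin of ★ p859880 (T5s♭-RamM, LH4-p11 (g7), seat closed 11:45Z «the cut twin = this ★ minus the same band via LH4-p04's ★ p859810 §1∕§2 — one rw»);
dealer∕pen LH4-plan (g13) WORD #65 (2) «their cut twins are then one `rw` each»; consumer LH4-p07 (g9) (LAW)), 2026-09-04.
-/
import Summits.HodgeConjecture.HodgeConjecture.Theorems.F0P3cDyRamToricCensusSumRamMFlip     -- ★ p859880 (LH4-p11 (g7)): T5s♭-RamM `toricCensusSum_ramM_flip`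
import Summits.HodgeConjecture.HodgeConjecture.Theorems.F0P3cDyRamToricCensusSumRamMCutoff   -- ★ p859810 (this seat): `sum_cut_part_eq_ramM`, `filter_band_eq_Ioc_ramM` (the RamM cut top band, parity-free)
import Summits.HodgeConjecture.HodgeConjecture.Theorems.F0P3cDyRamToricCensusSumRamKCutOffset  -- ★ p859832 (LH4-p07 (g9)): `cutSum_eq_of_agree_below_alive` (the re-cut step, type-free)
import HarnessLib

/-!
# Crux `H413`, line LH4 «(D-RAM) FOUR-FRAME» — STAGE-1b, row (2): (T5s♭-RamM, R2 FORM) «THE FLIPPED-CLASS TYPE-RamM TORIC CENSUS SUM MINUS THE CUT TOP BAND»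
# `ε·Σ_{j ≤ jl} Σ_a q^a·[j + a ≤ C]·(vP − vM) = q^m·(2[(jl + 1 − g)∕2 + d_E%2]_q − 2[d_E − 1 + d_E%2]_q) − 2·Σ_{a ∈ cut band} q^{a + ⌊(jl+s0)∕2⌋}`,  `jl ≤ C`, `d_E = g + s0`

Cell `hodgecm-mathlib` (D-0151), FLOOR 0, crux item H413 = `stmt-HodgeConjecture-24833`, route of record `HCCMUnconditional`; squad F0∕P3c∕LH4; lane
`--supports stmt-HodgeConjecture-24833 --as helper` (count-neutral; pays NO tier-0 row).  THEOREMS ONLY (no `def`, no instance, no notation, no `sorry`, default heartbeats).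
The one-`rw` composition LH4-p11 (g7) named when closing the (T5s♭-RamM) seat: ★ p859880 `toricCensusSum_ramM_flip` (the flipped parity class `jl ≢ g`, `m ≢ d_E (2)` of the
type-RamM toric census sum — the odd-`a′` level pieces at a RamM place) MINUS the cut top band of ★ p859810 §2 `sum_cut_part_eq_ramM`, which is parity-free (its hypotheses are
`hg hm hC hvOff hvTop` only; the top-cell exponent `a + ⌊(jl+s0)∕2⌋` holds in both parities of `jl + s0`).  Shape = ★ p859810 `toricCensusSum_ramM_cut` ∕ `_cut_Ioc` token for token
with ★ p859880's four flipped letters (`hjl : jl % 2 = (g + 1) % 2`, `hjlS : 3g + 2s0 ≤ jl + 3`, `hpar : m % 2 = (g + s0 + 1) % 2`, `hmS : g + s0 ≤ m + 1`) and its value.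
* `toricCensusSum_ramM_flip_cut` — ★ p859880's binders VERBATIM + `(C) (hC : jl ≤ C)`: `ε·ΣΣ q^a·[j + a ≤ C]·(vP − vM) = (★ p859880's value) − 2·Σ_{a ∈ band(C)} q^{a + ⌊(jl+s0)∕2⌋}`,
  band(C) = `a ≤ m ∧ C + m < jl + 2a ∧ 2m + 2g + s0 < jl + 2a + 2 ∧ 2a + d_E ≤ 2m + 1` (★ p859810's, VERBATIM);
* `toricCensusSum_ramM_flip_cut_Ioc` — under `m + 2g + s0 ≤ C + 2` the band is `Ioc ((C + m − jl)∕2) ((2m + 1 − d_E)∕2)` (★ p859810 `filter_band_eq_Ioc_ramM`); `m + jl ≤ C` recovers ★ p859880 (R0).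
HONEST LABEL.  Count-neutral finite-sum bookkeeping over `ℚ` on ABSTRACT tables; nothing printed is asserted; no census law is stated; `HC_CM` is proved only modulo the 7 printed
citations (2 remaining named inputs: hLiu418 = `stmt-HodgeConjecture-24832`, h413 = `stmt-HodgeConjecture-24833`) until rung 0 closes.
## References
* [Kottwitz1986BaseChangeUnits] R. E. Kottwitz, *Base change for unit elements of Hecke algebras*, Compositio Math. 60 (1986): §1 pp. 240–241.
* [Rogawski1990] J. D. Rogawski, *Automorphic Representations of Unitary Groups in Three Variables*, Ann. of Math. Stud. 123 (1990): §4.9 Prop. 4.9.1 (b) p. 55, Lemma 4.9.3 p. 56.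
* [Flicker1998UnitaryFL] Y. Z. Flicker, *Elementary proof of the fundamental lemma for a unitary group*, Canad. J. Math. 50 (1998): Prop. 7 p. 84 (the level tables).
-/

set_option autoImplicit false

namespace Summit.HodgeConjecture.HodgeConjecture.Cruxes.H413.F0P3cDyRamToricCensusSumRamMFlipCutoff

open Finset
open Summit.HodgeConjecture.HodgeConjecture.Cruxes.H413.F0P3cDyRamToricCensusSumRamMFlip (toricCensusSum_ramM_flip)
open Summit.HodgeConjecture.HodgeConjecture.Cruxes.H413.F0P3cDyRamToricCensusSumRamMCutoff (sum_cut_part_eq_ramM filter_band_eq_Ioc_ramM)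
open Summit.HodgeConjecture.HodgeConjecture.Cruxes.H413.F0P3cDyRamToricCensusSumRamKCutOffset (cutSum_eq_of_agree_below_alive)

/-! ## §1 The flipped-class cut sum (★ p859880 minus ★ p859810's cut top band) -/

/-- **(T5s♭-RamM) WITH A DIAGONAL CUTOFF** — ★ p859880 `toricCensusSum_ramM_flip`'s binders VERBATIM plus a cutoff constant `C` with `jl ≤ C`:
`ε·Σ_{j ≤ jl} Σ_{a ≤ jl+1} q^a·[j + a ≤ C]·(vP − vM) = q^m·(2[(jl + 1 − g)∕2 + (g+s0)%2]_q − 2[(g+s0) − 1 + (g+s0)%2]_q) − 2·Σ_{a ∈ band(C)} q^{a + ⌊(jl+s0)∕2⌋}` — ★ p859880 minus ★ p859810's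
cut top band (`sum_cut_part_eq_ramM`, parity-free); the (R2) form the odd-`a′` level pieces consume near `1` at a RamM place.
[cite: Kottwitz1986BaseChangeUnits, §1 pp. 240–241] [cite: Rogawski1990, §4.9 Prop. 4.9.1 (b) p. 55, Lemma 4.9.3 p. 56] [cite: Flicker1998UnitaryFL, Prop. 7 p. 84] -/
theorem toricCensusSum_ramM_flip_cut (q : ℕ) {g s0 jl m : ℕ} (ε : ℚ) (hq : 2 ≤ q) (hg : 1 ≤ g) (hs0 : 1 ≤ s0) (hjl : jl % 2 = (g + 1) % 2)
    (hjlS : 3 * g + 2 * s0 ≤ jl + 3) (hpar : m % 2 = (g + s0 + 1) % 2) (hmS : g + s0 ≤ m + 1) (hm : m ≤ jl)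
    (hε : ε = 1 ∨ (ε = -1 ∧ jl + 2 ≤ m + 2 * g + s0))
    (nP nM vP vM : ℕ → ℕ → ℚ)
    (hnP : ∀ j a, nP j a = ((if j = 0 then (if a = 0 then 1 else 0) else if j < a then 0
      else if j - a + 1 = s0 then q ^ j else if j - a + 1 < s0 then (if a = 0 then q ^ j else 0) else if (j - a - s0) % 2 = 1 then 0
      else if a = 0 then (if 2 * g ≤ j - a - s0 then 2 else 1) * q ^ (j - (j - a - s0) / 2)
      else if j - a - s0 + 2 < 2 * g then (q - 1) * q ^ (j - 1 - (j - a - s0) / 2) else if j - a - s0 + 2 = 2 * g then (q - 2) * q ^ (j - 1 - (j - a - s0) / 2)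
      else 2 * (q - 1) * q ^ (j - 1 - (j - a - s0) / 2) : ℕ) : ℚ))
    (hnM : ∀ j a, nM j a = ((if j = 0 then (if a = 0 then 1 else 0) else if j < a then 0
      else if j - a + 1 = s0 then q ^ j else if j - a + 1 < s0 then (if a = 0 then q ^ j else 0) else if (j - a - s0) % 2 = 1 then 0
      else if a = 0 then (if j - a - s0 + 2 ≤ 2 * g then q ^ (j - (j - a - s0) / 2) else 0)
      else if j - a - s0 + 2 < 2 * g then (q - 1) * q ^ (j - 1 - (j - a - s0) / 2) else if j - a - s0 + 2 = 2 * g then q ^ (j - (j - a - s0) / 2) else 0 : ℕ) : ℚ))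
    (hvGen : ∀ j a, (a ≤ m ∧ (j + a ≤ m ∨ (2 * a ≤ m ∧ j + a ≤ jl))) → vP j a = nP j a ∧ vM j a = nM j a)
    (hvOff : ∀ j a, ¬ (a ≤ m ∧ (j + a ≤ m ∨ (2 * a ≤ m ∧ j + a ≤ jl))) → j + m ≠ jl + a → vP j a = 0 ∧ vM j a = 0)
    (hvTop : ∀ j a, ¬ (a ≤ m ∧ (j + a ≤ m ∨ (2 * a ≤ m ∧ j + a ≤ jl))) → j + m = jl + a →
      (vP j a = if 2 * j + (g + s0) ≤ 2 * jl + 1 ∧ (j + a + 2 ≤ m + s0 + 2 * g ∨ ε = 1) then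
          (if j + a < m + s0 then (q : ℚ) ^ j else (if 2 * g ≤ j + a - m - s0 + 1 then 2 else 1) * (q : ℚ) ^ (j - (j + a - m - s0 + 1) / 2)) else 0) ∧
      (vM j a = if 2 * j + (g + s0) ≤ 2 * jl + 1 ∧ (j + a + 2 ≤ m + s0 + 2 * g ∨ ε = -1) then
          (if j + a < m + s0 then (q : ℚ) ^ j else (if 2 * g ≤ j + a - m - s0 + 1 then 2 else 1) * (q : ℚ) ^ (j - (j + a - m - s0 + 1) / 2)) else 0))
    (C : ℕ) (hC : jl ≤ C) :
    ε * ∑ j ∈ range (jl + 1), ∑ a ∈ range (jl + 2), (q : ℚ) ^ a * (if j + a ≤ C then vP j a - vM j a else 0) =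
      (q : ℚ) ^ m * (2 * ∑ i ∈ range ((jl + 1 - g) / 2 + (g + s0) % 2), (q : ℚ) ^ i - 2 * ∑ i ∈ range (g + s0 - 1 + (g + s0) % 2), (q : ℚ) ^ i) -
        2 * ∑ a ∈ (range (jl + 2)).filter (fun a => a ≤ m ∧ C + m < jl + 2 * a ∧ 2 * m + 2 * g + s0 < jl + 2 * a + 2 ∧ 2 * a + (g + s0) ≤ 2 * m + 1), (q : ℚ) ^ (a + (jl + s0) / 2) := by
  have hε' : ε = 1 ∨ ε = -1 := hε.imp_right And.left
  have hsplit : ∀ j a, (q : ℚ) ^ a * (if j + a ≤ C then vP j a - vM j a else 0) =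
      (q : ℚ) ^ a * (vP j a - vM j a) - (q : ℚ) ^ a * (if C < j + a then vP j a - vM j a else 0) := fun j a => by
    by_cases h : j + a ≤ C
    · rw [if_pos h, if_neg (not_lt.2 h), mul_zero, sub_zero]
    · rw [if_neg h, if_pos (not_le.1 h), mul_zero, sub_self]
  simp_rw [hsplit]
  simp only [Finset.sum_sub_distrib]
  rw [mul_sub, toricCensusSum_ramM_flip q ε hq hg hs0 hjl hjlS hpar hmS hm hε nP nM vP vM hnP hnM hvGen hvOff hvTop,
    sum_cut_part_eq_ramM (q : ℚ) ε hε' hg hm hC vP vM hvOff hvTop]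

/-- **(T5s♭-RamM) WITH A DIAGONAL CUTOFF, INTERVAL FORM**: under `m + 2g + s0 ≤ C + 2` the band is `a ∈ Ioc ((C + m − jl)∕2) ((2m + 1 − (g + s0))∕2)` (★ p859810
`filter_band_eq_Ioc_ramM`); for `m + jl ≤ C` it is empty and ★ p859880 is recovered (regime (R0)). [cite: Kottwitz1986BaseChangeUnits, §1 pp. 240–241] [cite: Flicker1998UnitaryFL, Prop. 7 p. 84] -/
theorem toricCensusSum_ramM_flip_cut_Ioc (q : ℕ) {g s0 jl m : ℕ} (ε : ℚ) (hq : 2 ≤ q) (hg : 1 ≤ g) (hs0 : 1 ≤ s0) (hjl : jl % 2 = (g + 1) % 2)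
    (hjlS : 3 * g + 2 * s0 ≤ jl + 3) (hpar : m % 2 = (g + s0 + 1) % 2) (hmS : g + s0 ≤ m + 1) (hm : m ≤ jl)
    (hε : ε = 1 ∨ (ε = -1 ∧ jl + 2 ≤ m + 2 * g + s0))
    (nP nM vP vM : ℕ → ℕ → ℚ)
    (hnP : ∀ j a, nP j a = ((if j = 0 then (if a = 0 then 1 else 0) else if j < a then 0
      else if j - a + 1 = s0 then q ^ j else if j - a + 1 < s0 then (if a = 0 then q ^ j else 0) else if (j - a - s0) % 2 = 1 then 0
      else if a = 0 then (if 2 * g ≤ j - a - s0 then 2 else 1) * q ^ (j - (j - a - s0) / 2)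
      else if j - a - s0 + 2 < 2 * g then (q - 1) * q ^ (j - 1 - (j - a - s0) / 2) else if j - a - s0 + 2 = 2 * g then (q - 2) * q ^ (j - 1 - (j - a - s0) / 2)
      else 2 * (q - 1) * q ^ (j - 1 - (j - a - s0) / 2) : ℕ) : ℚ))
    (hnM : ∀ j a, nM j a = ((if j = 0 then (if a = 0 then 1 else 0) else if j < a then 0
      else if j - a + 1 = s0 then q ^ j else if j - a + 1 < s0 then (if a = 0 then q ^ j else 0) else if (j - a - s0) % 2 = 1 then 0
      else if a = 0 then (if j - a - s0 + 2 ≤ 2 * g then q ^ (j - (j - a - s0) / 2) else 0)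
      else if j - a - s0 + 2 < 2 * g then (q - 1) * q ^ (j - 1 - (j - a - s0) / 2) else if j - a - s0 + 2 = 2 * g then q ^ (j - (j - a - s0) / 2) else 0 : ℕ) : ℚ))
    (hvGen : ∀ j a, (a ≤ m ∧ (j + a ≤ m ∨ (2 * a ≤ m ∧ j + a ≤ jl))) → vP j a = nP j a ∧ vM j a = nM j a)
    (hvOff : ∀ j a, ¬ (a ≤ m ∧ (j + a ≤ m ∨ (2 * a ≤ m ∧ j + a ≤ jl))) → j + m ≠ jl + a → vP j a = 0 ∧ vM j a = 0)
    (hvTop : ∀ j a, ¬ (a ≤ m ∧ (j + a ≤ m ∨ (2 * a ≤ m ∧ j + a ≤ jl))) → j + m = jl + a →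
      (vP j a = if 2 * j + (g + s0) ≤ 2 * jl + 1 ∧ (j + a + 2 ≤ m + s0 + 2 * g ∨ ε = 1) then
          (if j + a < m + s0 then (q : ℚ) ^ j else (if 2 * g ≤ j + a - m - s0 + 1 then 2 else 1) * (q : ℚ) ^ (j - (j + a - m - s0 + 1) / 2)) else 0) ∧
      (vM j a = if 2 * j + (g + s0) ≤ 2 * jl + 1 ∧ (j + a + 2 ≤ m + s0 + 2 * g ∨ ε = -1) then
          (if j + a < m + s0 then (q : ℚ) ^ j else (if 2 * g ≤ j + a - m - s0 + 1 then 2 else 1) * (q : ℚ) ^ (j - (j + a - m - s0 + 1) / 2)) else 0))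
    (C : ℕ) (hC : jl ≤ C) (hfar : m + 2 * g + s0 ≤ C + 2) :
    ε * ∑ j ∈ range (jl + 1), ∑ a ∈ range (jl + 2), (q : ℚ) ^ a * (if j + a ≤ C then vP j a - vM j a else 0) =
      (q : ℚ) ^ m * (2 * ∑ i ∈ range ((jl + 1 - g) / 2 + (g + s0) % 2), (q : ℚ) ^ i - 2 * ∑ i ∈ range (g + s0 - 1 + (g + s0) % 2), (q : ℚ) ^ i) -
        2 * ∑ a ∈ Finset.Ioc ((C + m - jl) / 2) ((2 * m + 1 - (g + s0)) / 2), (q : ℚ) ^ (a + (jl + s0) / 2) := by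
  rw [toricCensusSum_ramM_flip_cut q ε hq hg hs0 hjl hjlS hpar hmS hm hε nP nM vP vM hnP hnM hvGen hvOff hvTop C hC, filter_band_eq_Ioc_ramM hg hs0 hm hC hfar]

/-! ## §2 The flipped-class cut sum with an alive offset (★ p859832's re-cut step, type RamM) -/

/-- **(T5s♭-RamM) WITH A DIAGONAL CUTOFF AND AN ALIVE OFFSET.**  ★ p859880's binders with the top rows' alive condition SHIFTED to `2j + d_E ≤ 2jl + 1 + e` (`hvTopE`, any `e : ℕ`;
the cells of a SCALED multiplier are alive up to the UNSCALED conductor, LH4-p07 (g9)'s ★ p859832), a cutoff `C` with `jl ≤ C` and `C + d_E ≤ m + jl + 1` (the offset band is cut):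
the cut sum has §1's value VERBATIM.  Proof = ★ p859832's two steps: re-cut the tables at the standard boundary (`cutSum_eq_of_agree_below_alive`, imported), then §1.
[cite: Kottwitz1986BaseChangeUnits, §1 pp. 240–241] [cite: Rogawski1990, §4.9 Prop. 4.9.1 (b) p. 55, Lemma 4.9.3 p. 56] [cite: Flicker1998UnitaryFL, Prop. 7 p. 84] -/
theorem toricCensusSum_ramM_flip_cut_offset (q : ℕ) {g s0 jl m : ℕ} (ε : ℚ) (hq : 2 ≤ q) (hg : 1 ≤ g) (hs0 : 1 ≤ s0) (hjl : jl % 2 = (g + 1) % 2)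
    (hjlS : 3 * g + 2 * s0 ≤ jl + 3) (hpar : m % 2 = (g + s0 + 1) % 2) (hmS : g + s0 ≤ m + 1) (hm : m ≤ jl)
    (hε : ε = 1 ∨ (ε = -1 ∧ jl + 2 ≤ m + 2 * g + s0))
    (nP nM vP vM : ℕ → ℕ → ℚ)
    (hnP : ∀ j a, nP j a = ((if j = 0 then (if a = 0 then 1 else 0) else if j < a then 0
      else if j - a + 1 = s0 then q ^ j else if j - a + 1 < s0 then (if a = 0 then q ^ j else 0) else if (j - a - s0) % 2 = 1 then 0
      else if a = 0 then (if 2 * g ≤ j - a - s0 then 2 else 1) * q ^ (j - (j - a - s0) / 2)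
      else if j - a - s0 + 2 < 2 * g then (q - 1) * q ^ (j - 1 - (j - a - s0) / 2) else if j - a - s0 + 2 = 2 * g then (q - 2) * q ^ (j - 1 - (j - a - s0) / 2)
      else 2 * (q - 1) * q ^ (j - 1 - (j - a - s0) / 2) : ℕ) : ℚ))
    (hnM : ∀ j a, nM j a = ((if j = 0 then (if a = 0 then 1 else 0) else if j < a then 0
      else if j - a + 1 = s0 then q ^ j else if j - a + 1 < s0 then (if a = 0 then q ^ j else 0) else if (j - a - s0) % 2 = 1 then 0
      else if a = 0 then (if j - a - s0 + 2 ≤ 2 * g then q ^ (j - (j - a - s0) / 2) else 0)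
      else if j - a - s0 + 2 < 2 * g then (q - 1) * q ^ (j - 1 - (j - a - s0) / 2) else if j - a - s0 + 2 = 2 * g then q ^ (j - (j - a - s0) / 2) else 0 : ℕ) : ℚ))
    (hvGen : ∀ j a, (a ≤ m ∧ (j + a ≤ m ∨ (2 * a ≤ m ∧ j + a ≤ jl))) → vP j a = nP j a ∧ vM j a = nM j a)
    (hvOff : ∀ j a, ¬ (a ≤ m ∧ (j + a ≤ m ∨ (2 * a ≤ m ∧ j + a ≤ jl))) → j + m ≠ jl + a → vP j a = 0 ∧ vM j a = 0)
    (e : ℕ)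
    (hvTopE : ∀ j a, ¬ (a ≤ m ∧ (j + a ≤ m ∨ (2 * a ≤ m ∧ j + a ≤ jl))) → j + m = jl + a →
      (vP j a = if 2 * j + (g + s0) ≤ 2 * jl + 1 + e ∧ (j + a + 2 ≤ m + s0 + 2 * g ∨ ε = 1) then
          (if j + a < m + s0 then (q : ℚ) ^ j else (if 2 * g ≤ j + a - m - s0 + 1 then 2 else 1) * (q : ℚ) ^ (j - (j + a - m - s0 + 1) / 2)) else 0) ∧
      (vM j a = if 2 * j + (g + s0) ≤ 2 * jl + 1 + e ∧ (j + a + 2 ≤ m + s0 + 2 * g ∨ ε = -1) then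
          (if j + a < m + s0 then (q : ℚ) ^ j else (if 2 * g ≤ j + a - m - s0 + 1 then 2 else 1) * (q : ℚ) ^ (j - (j + a - m - s0 + 1) / 2)) else 0))
    (C : ℕ) (hC : jl ≤ C) (hCe : C + (g + s0) ≤ m + jl + 1) :
    ε * ∑ j ∈ range (jl + 1), ∑ a ∈ range (jl + 2), (q : ℚ) ^ a * (if j + a ≤ C then vP j a - vM j a else 0) =
      (q : ℚ) ^ m * (2 * ∑ i ∈ range ((jl + 1 - g) / 2 + (g + s0) % 2), (q : ℚ) ^ i - 2 * ∑ i ∈ range (g + s0 - 1 + (g + s0) % 2), (q : ℚ) ^ i) -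
        2 * ∑ a ∈ (range (jl + 2)).filter (fun a => a ≤ m ∧ C + m < jl + 2 * a ∧ 2 * m + 2 * g + s0 < jl + 2 * a + 2 ∧ 2 * a + (g + s0) ≤ 2 * m + 1), (q : ℚ) ^ (a + (jl + s0) / 2) := by
  classical
  -- the standard-alive tables: the given ones, re-cut at `2j + d_E ≤ 2jl + 1` on the top diagonal
  set wP : ℕ → ℕ → ℚ := fun j a => if ¬ (a ≤ m ∧ (j + a ≤ m ∨ (2 * a ≤ m ∧ j + a ≤ jl))) ∧ j + m = jl + a then
      (if 2 * j + (g + s0) ≤ 2 * jl + 1 ∧ (j + a + 2 ≤ m + s0 + 2 * g ∨ ε = 1) then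
          (if j + a < m + s0 then (q : ℚ) ^ j else (if 2 * g ≤ j + a - m - s0 + 1 then 2 else 1) * (q : ℚ) ^ (j - (j + a - m - s0 + 1) / 2)) else 0)
    else vP j a with hwP
  set wM : ℕ → ℕ → ℚ := fun j a => if ¬ (a ≤ m ∧ (j + a ≤ m ∨ (2 * a ≤ m ∧ j + a ≤ jl))) ∧ j + m = jl + a then
      (if 2 * j + (g + s0) ≤ 2 * jl + 1 ∧ (j + a + 2 ≤ m + s0 + 2 * g ∨ ε = -1) then
          (if j + a < m + s0 then (q : ℚ) ^ j else (if 2 * g ≤ j + a - m - s0 + 1 then 2 else 1) * (q : ℚ) ^ (j - (j + a - m - s0 + 1) / 2)) else 0)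
    else vM j a with hwM
  have hwGen : ∀ j a, (a ≤ m ∧ (j + a ≤ m ∨ (2 * a ≤ m ∧ j + a ≤ jl))) → wP j a = nP j a ∧ wM j a = nM j a := fun j a hg => by
    obtain ⟨h1, h2⟩ := hvGen j a hg
    rw [hwP, hwM]; dsimp only
    rw [if_neg (fun h => h.1 hg), if_neg (fun h => h.1 hg), h1, h2]
    exact ⟨rfl, rfl⟩
  have hwOff : ∀ j a, ¬ (a ≤ m ∧ (j + a ≤ m ∨ (2 * a ≤ m ∧ j + a ≤ jl))) → j + m ≠ jl + a → wP j a = 0 ∧ wM j a = 0 := fun j a hg hoff => by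
    obtain ⟨h1, h2⟩ := hvOff j a hg hoff
    rw [hwP, hwM]; dsimp only
    rw [if_neg (fun h => hoff h.2), if_neg (fun h => hoff h.2), h1, h2]
    exact ⟨rfl, rfl⟩
  have hwTop : ∀ j a, ¬ (a ≤ m ∧ (j + a ≤ m ∨ (2 * a ≤ m ∧ j + a ≤ jl))) → j + m = jl + a →
      (wP j a = if 2 * j + (g + s0) ≤ 2 * jl + 1 ∧ (j + a + 2 ≤ m + s0 + 2 * g ∨ ε = 1) then
          (if j + a < m + s0 then (q : ℚ) ^ j else (if 2 * g ≤ j + a - m - s0 + 1 then 2 else 1) * (q : ℚ) ^ (j - (j + a - m - s0 + 1) / 2)) else 0) ∧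
      (wM j a = if 2 * j + (g + s0) ≤ 2 * jl + 1 ∧ (j + a + 2 ≤ m + s0 + 2 * g ∨ ε = -1) then
          (if j + a < m + s0 then (q : ℚ) ^ j else (if 2 * g ≤ j + a - m - s0 + 1 then 2 else 1) * (q : ℚ) ^ (j - (j + a - m - s0 + 1) / 2)) else 0) :=
    fun j a hg htop => by
    have hc : ¬ (a ≤ m ∧ (j + a ≤ m ∨ (2 * a ≤ m ∧ j + a ≤ jl))) ∧ j + m = jl + a := ⟨hg, htop⟩
    rw [hwP, hwM]; dsimp only
    rw [if_pos hc, if_pos hc]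
    exact ⟨rfl, rfl⟩
  -- the two cut sums agree: the tables differ only on top cells beyond the standard alive boundary, and those are cut
  have hagree : ∀ j a, ¬ (j + m = jl + a ∧ 2 * jl + 1 < 2 * j + (g + s0)) → vP j a = wP j a ∧ vM j a = wM j a := fun j a hna => by
    rw [hwP, hwM]; dsimp only
    by_cases hcase : ¬ (a ≤ m ∧ (j + a ≤ m ∨ (2 * a ≤ m ∧ j + a ≤ jl))) ∧ j + m = jl + a
    · rw [if_pos hcase, if_pos hcase]
      obtain ⟨hP, hM⟩ := hvTopE j a hcase.1 hcase.2
      have halive : 2 * j + (g + s0) ≤ 2 * jl + 1 := by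
        by_contra hlt
        exact hna ⟨hcase.2, by omega⟩
      have hiffP : (2 * j + (g + s0) ≤ 2 * jl + 1 + e ∧ (j + a + 2 ≤ m + s0 + 2 * g ∨ ε = 1)) ↔ (2 * j + (g + s0) ≤ 2 * jl + 1 ∧ (j + a + 2 ≤ m + s0 + 2 * g ∨ ε = 1)) := by
        constructor <;> rintro ⟨h1, h2⟩ <;> exact ⟨by omega, h2⟩
      have hiffM : (2 * j + (g + s0) ≤ 2 * jl + 1 + e ∧ (j + a + 2 ≤ m + s0 + 2 * g ∨ ε = -1)) ↔ (2 * j + (g + s0) ≤ 2 * jl + 1 ∧ (j + a + 2 ≤ m + s0 + 2 * g ∨ ε = -1)) := by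
        constructor <;> rintro ⟨h1, h2⟩ <;> exact ⟨by omega, h2⟩
      rw [hP, hM, if_congr hiffP rfl rfl, if_congr hiffM rfl rfl]
      exact ⟨rfl, rfl⟩
    · rw [if_neg hcase, if_neg hcase]
      exact ⟨rfl, rfl⟩
  rw [cutSum_eq_of_agree_below_alive (q : ℚ) hCe vP vM wP wM hagree]
  exact toricCensusSum_ramM_flip_cut q ε hq hg hs0 hjl hjlS hpar hmS hm hε nP nM wP wM hnP hnM hwGen hwOff hwTop C hC

end Summit.HodgeConjecture.HodgeConjecture.Cruxes.H413.F0P3cDyRamToricCensusSumRamMFlipCutoff
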